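import Mathlib
import Summits.KontsevichZagierPeriods.Zeta5Search.Families.RayGrowthTransport
import HarnessLib

/-!
# ζ(5) search — Families: transport certificates by `decide` alone — a turnkey API for designers

HONEST FRAMING: systematic search; no irrationality claim unless certified.  STRUCTURAL (size of cellular integrals);
nothing about the arithmetic of any zeta value.  Seat P2, Families layer.

`Families/BasicGrowthTransport.lean` / `RayGrowthTransport.lean` bound a growth constant by an integer transport plan,
after which each instance still needed a `norm_num` step on large real numerals.  Here the whole certificate is moved to
`ℕ`, so that a designer certifies a decay rate with NOTHING BUT `decide`:

* **`fSup_le_of_natCert`** — basic family of any bijective seating `σ` on `ℓ + 3` points: if `p` is an integer plan of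
  weight `q ≥ 1` (support / row sums / column sums — three decidable conditions) and `num, den : ℕ`, `den ≥ 1`, satisfy
  the decidable inequality `den^q · ∏ p^p ≤ num^q · q^{q(ℓ+1)}`, then **`M_σ ≤ num / den`**;
* **`bzSup_le_of_natCert`** — the same for every Brown–Zudilin ray `a` in the cone (3) (`σ = ₈π₈^∨`, margins
  `q·bzDen a`, `q·bzNum a`): `den^q · ∏ p^p ≤ num^q · ∏_i (Σ_w p(i,w))^{Σ_w p(i,w)}` ⟹ **`bzSup a ≤ num / den`**;
* `bzSup_thm1_le_api` — usage example: the record direction, `bzSup(8,16,10,15,12,16,18,13) ≤ 208/10³¹` re-derived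
  with four `decide`s and no real arithmetic (plan `thm1Plan` of `RayGrowthTransport`).
RECIPE (for a direction `a`): run `HOME/pub-zeta5-p2/g4/raycert.py` (Sinkhorn scaling → rounded plan `p` of weight
`q`, and the bound `e^{ℓ}`); pick `num/den ≥ e^{ℓ}`; state `bzSup a ≤ num/den := bzSup_le_of_natCert ha q (by norm_num) p (by decide)
(by decide) (by decide) (by norm_num) (by decide)`.  Standard axioms only.
-/

noncomputable section

open MeasureTheory Set Finset Filter Topology

namespace Summit.KontsevichZagierPeriods.Zeta5Search.Families.Cellular

open Literature.NumberTheory.Irrationality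

variable {ℓ : ℕ} (σ : Fin (ℓ + 3) → Fin (ℓ + 3))

/-- From `M^q · C ≤ P`, `den^q · P ≤ num^q · C` (naturals) and `C > 0`: `M ≤ num/den`. -/
private theorem le_div_of_pow_mul_le {M C P : ℝ} {q num den : ℕ} (hq : 0 < q) (hC : 0 < C)
    (hden : 0 < den) (h1 : M ^ q * C ≤ P) (h2 : (den : ℝ) ^ q * P ≤ (num : ℝ) ^ q * C) :
    M ≤ num / den := by
  have hdenR : (0 : ℝ) < den := by exact_mod_cast hden
  have h3 : (M * den) ^ q * C ≤ (num : ℝ) ^ q * C := by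
    calc (M * den) ^ q * C = (den : ℝ) ^ q * (M ^ q * C) := by rw [mul_pow]; ring
      _ ≤ (den : ℝ) ^ q * P := mul_le_mul_of_nonneg_left h1 (by positivity)
      _ ≤ (num : ℝ) ^ q * C := h2
  have h4 : (M * den) ^ q ≤ (num : ℝ) ^ q := le_of_mul_le_mul_right h3 hC
  have h5 : M * den ≤ num := le_of_pow_le_pow_left₀ hq.ne' (Nat.cast_nonneg _) h4
  rw [le_div_iff₀ hdenR]
  exact h5

/-- **Basic-family certificate by `decide`.**  For a bijective seating on `ℓ + 3` points, an integer plan `p` of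
weight `q ≥ 1` (support in the finite spans, row sums `q` on finite edges, column sums `q`) and naturals `num`,
`den ≥ 1` with `den^q · ∏ p^p ≤ num^q · q^{q(ℓ+1)}`: `M_σ ≤ num / den`. -/
theorem fSup_le_of_natCert (hσ : Function.Bijective σ) (q : ℕ) (hq : 0 < q) (p : Fin (ℓ + 3) → Fin (ℓ + 1) → ℕ)
    (hsupp : ∀ i w, p i w ≠ 0 → ((σ i).val ≠ ℓ + 2 ∧ (σ (i + 1)).val ≠ ℓ + 2) ∧
      min (σ i).val (σ (i + 1)).val ≤ w.val ∧ w.val < max (σ i).val (σ (i + 1)).val)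
    (hrow : ∀ i, ((σ i).val ≠ ℓ + 2 ∧ (σ (i + 1)).val ≠ ℓ + 2) → ∑ w, p i w = q)
    (hcol : ∀ w, ∑ i, p i w = q) {num den : ℕ} (hden : 0 < den)
    (hineq : den ^ q * ∏ i, ∏ w, p i w ^ p i w ≤ num ^ q * q ^ (q * (ℓ + 1))) :
    fSup σ ≤ num / den := by
  have h1 := fSup_pow_mul_le_of_transport σ hσ hq p hsupp hrow hcol
  refine le_div_of_pow_mul_le hq (by positivity) hden h1 ?_
  exact_mod_cast hineq

/-- **Brown–Zudilin ray certificate by `decide`.**  For `a` in the cone (3), an integer plan `p` of weight `q ≥ 1`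
with row sums `q·bzDen a` on the finite edges of `₈π₈^∨` and column sums `q·bzNum a`, and naturals `num`, `den ≥ 1`
with `den^q · ∏ p^p ≤ num^q · ∏_i (Σ_w p(i,w))^{Σ_w p(i,w)}`: `bzSup a ≤ num / den`. -/
theorem bzSup_le_of_natCert {a : Fin 8 → ℤ} (ha : BrownZudilin2022.Converges a) (q : ℕ) (hq : 0 < q)
    (p : Fin 8 → Fin 6 → ℕ)
    (hsupp : ∀ i w, p i w ≠ 0 → ((pi8dual i).val ≠ 5 + 2 ∧ (pi8dual (i + 1)).val ≠ 5 + 2) ∧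
      min (pi8dual i).val (pi8dual (i + 1)).val ≤ w.val ∧ w.val < max (pi8dual i).val (pi8dual (i + 1)).val)
    (hrow : ∀ i, ((pi8dual i).val ≠ 5 + 2 ∧ (pi8dual (i + 1)).val ≠ 5 + 2) →
      ((∑ w, p i w : ℕ) : ℤ) = q * bzDen a i)
    (hcol : ∀ w : Fin 6, ((∑ i, p i w : ℕ) : ℤ) = q * bzNum a ⟨w.val, by omega⟩) {num den : ℕ} (hden : 0 < den)
    (hineq : den ^ q * ∏ i, ∏ w, p i w ^ p i w ≤ num ^ q * ∏ i, (∑ w, p i w) ^ (∑ w, p i w)) :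
    bzSup a ≤ num / den := by
  have h1 := bzSup_pow_mul_le_of_transport ha hq p hsupp hrow hcol
  have hC : (0 : ℝ) < ∏ i, ((∑ w, p i w : ℕ) : ℝ) ^ (∑ w, p i w) := Finset.prod_pos fun i _ => by
    rcases Nat.eq_zero_or_pos (∑ w, p i w) with h | h
    · rw [h, pow_zero]; exact one_pos
    · exact pow_pos (by exact_mod_cast h) _
  refine le_div_of_pow_mul_le hq hC hden h1 ?_
  exact_mod_cast hineq

set_option exponentiation.threshold 4096 in
set_option maxRecDepth 8192 in
/-- Usage example: **`bzSup(8,16,10,15,12,16,18,13) ≤ 208/10³¹`** from the weight-`5` plan `thm1Plan` with `decide`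
only (cf. `bzSup_thm1_le`, proved there with `norm_num`). -/
theorem bzSup_thm1_le_api : bzSup thm1Dir ≤ (208 : ℕ) / (10 ^ 31 : ℕ) :=
  bzSup_le_of_natCert BrownZudilin2022.converges_thm1_vector 5 (by norm_num) thm1Plan
    (by decide) (by decide) (by decide) (by norm_num) (by decide)

end Summit.KontsevichZagierPeriods.Zeta5Search.Families.Cellular
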